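import Summits.AtomisticToContinuum.FouriersLaw.Theses.BondHeatUncertainty
import Summits.AtomisticToContinuum.FouriersLaw.Theorems.BondHeatUncertaintySubdiffusiveBondHeatKernelGibbsA
import Literature.MathematicalPhysics.KineticTheory.LangevinChainScalingLimit

/-!
# The generator on the elementary observables and their energy bounds (helper 3 for `stub_steadyHeatRates`)

Helper file for crux `stmt-AtomisticToContinuum-9122` (`BondHeatUncertainty.LinearResponseFTUR`), line
`lebesgue-flip-duality`, stub `stub_steadyHeatRates`. The steady heat rates follow from weak stationarity tested on
three families of ELEMENTARY observables of an oscillator chain: the kinetic energies `k_i = p_i²/2`, the pinning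
energies `u_i = U(q_i)` and the bond energies `v_{ij} = V(q_j - q_i)`. Here (pure calculus, every `OscillatorChain`
with differentiable potentials where needed):

* `generator_kinetic` — `L k_i = -p_i ∂_{q_i}H + γ([i=0](T_L - p_i²) + [i=N-1](T_R - p_i²))`;
* `generator_pinning` — `L u_i = p_i U'(q_i)`;
* `generator_bondEnergy` — `L v_{ij} = (p_j - p_i) V'(q_j - q_i)` (`i ≠ j`);
* for chains with nonnegative potentials dominated by their own values (`|U'| ≤ A(1+U)`, `|V'| ≤ B(1+V)`): the bounds
  `|f|, |Lf|, |∂_{p_l} f| ≤ C (1 + H)²` for the three families (`abs_kinetic_le`, `abs_generator_kinetic_le`, …), and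
  the registered sub-goal `pinnedChain_elementaryBounds` packaging them for the pinned chain.

Nothing here closes an item. -/

noncomputable section

namespace Summit.AtomisticToContinuum.FouriersLaw.Theorems.LinearResponseFTUR

open MeasureTheory Filter Topology Set Finset
open scoped NNReal ENNReal
open Literature.MathematicalPhysics.KineticTheory
open Literature.MathematicalPhysics.KineticTheory.HeatConduction
open Summit.AtomisticToContinuum.FouriersLaw.Theorems.SubdiffusiveBondHeat

variable {N : ℕ}

/-! ### Coordinate derivatives of the elementary observables -/

/-- `∂_{p_j}(p_i²/2) = [j = i] p_i`. [folklore] -/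
theorem partialP_kinetic (i j : Fin N) (y : PhaseSpace N) :
    partialP j (fun z : PhaseSpace N => z.2 i ^ 2 / 2) y = if j = i then y.2 i else 0 := by
  unfold partialP
  by_cases hj : j = i
  · subst hj
    simp only [Function.update_self, if_true]
    have h : HasDerivAt (fun t : ℝ => t ^ 2 / 2) (y.2 j) (y.2 j) := by
      have h1 := (hasDerivAt_pow 2 (y.2 j)).div_const 2
      refine h1.congr_deriv ?_
      push_cast; ring
    exact h.deriv
  · have hne : i ≠ j := Ne.symm hj
    simp only [hj, if_false, Function.update_of_ne hne, deriv_const']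

/-- `∂_{p_j}(p_i²/2)` as a function. [folklore] -/
theorem partialP_kinetic_eq (i j : Fin N) :
    partialP j (fun z : PhaseSpace N => z.2 i ^ 2 / 2) = fun y => if j = i then y.2 i else 0 :=
  funext fun y => partialP_kinetic i j y

/-- `∂²_{p_j}(p_i²/2) = [j = i]`. [folklore] -/
theorem partialP_partialP_kinetic (i j : Fin N) (y : PhaseSpace N) :
    partialP j (partialP j (fun z : PhaseSpace N => z.2 i ^ 2 / 2)) y = if j = i then 1 else 0 := by
  rw [partialP_kinetic_eq]
  unfold partialP
  by_cases hj : j = i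
  · subst hj
    simp only [if_true, Function.update_self]
    exact (hasDerivAt_id' (y.2 j)).deriv
  · simp only [hj, if_false, deriv_const']

/-- `∂_{q_j}(p_i²/2) = 0`. [folklore] -/
theorem partialQ_kinetic (i j : Fin N) (y : PhaseSpace N) :
    partialQ j (fun z : PhaseSpace N => z.2 i ^ 2 / 2) y = 0 := by
  simp [partialQ]

/-- `∂_{p_j} U(q_i) = 0` (as a function). [folklore] -/
theorem partialP_pinning_eq (P : OscillatorChain) (i j : Fin N) :
    partialP j (fun z : PhaseSpace N => P.U (z.1 i)) = fun _ => 0 := by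
  funext y
  simp [partialP]

/-- `∂_{q_j} U(q_i) = [j = i] U'(q_i)`. [folklore] -/
theorem partialQ_pinning (P : OscillatorChain) (i j : Fin N) (y : PhaseSpace N) :
    partialQ j (fun z : PhaseSpace N => P.U (z.1 i)) y = if j = i then deriv P.U (y.1 i) else 0 := by
  unfold partialQ
  by_cases hj : j = i
  · subst hj
    simp only [Function.update_self, if_true]
  · have hne : i ≠ j := Ne.symm hj
    simp only [hj, if_false, Function.update_of_ne hne, deriv_const']

/-- `∂_{p_k} V(q_j - q_i) = 0` (as a function). [folklore] -/
theorem partialP_bondEnergy_eq (P : OscillatorChain) (i j k : Fin N) :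
    partialP k (fun z : PhaseSpace N => P.V (z.1 j - z.1 i)) = fun _ => 0 := by
  funext y
  simp [partialP]

/-- `∂_{q_k} V(q_j - q_i) = ([k = j] - [k = i]) V'(q_j - q_i)` for `i ≠ j` and differentiable `V`. [folklore] -/
theorem partialQ_bondEnergy (P : OscillatorChain) (hV : Differentiable ℝ P.V) {i j : Fin N} (hij : i ≠ j)
    (k : Fin N) (y : PhaseSpace N) :
    partialQ k (fun z : PhaseSpace N => P.V (z.1 j - z.1 i)) y =
      if k = j then deriv P.V (y.1 j - y.1 i) else if k = i then -deriv P.V (y.1 j - y.1 i) else 0 := by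
  unfold partialQ
  by_cases hkj : k = j
  · subst hkj
    simp only [if_true, Function.update_self, Function.update_of_ne hij]
    have hlin : HasDerivAt (fun t : ℝ => t - y.1 i) 1 (y.1 k) := by
      simpa using (hasDerivAt_id' (y.1 k)).sub_const (y.1 i)
    have h := (hV _).hasDerivAt.comp _ hlin
    rw [mul_one] at h
    exact h.deriv
  · simp only [hkj, if_false]
    by_cases hki : k = i
    · subst hki
      simp only [if_true, Function.update_self, Function.update_of_ne (Ne.symm hij)]
      have hlin : HasDerivAt (fun t : ℝ => y.1 j - t) (-1) (y.1 k) := by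
        simpa using (hasDerivAt_id' (y.1 k)).const_sub (y.1 j)
      have h := (hV _).hasDerivAt.comp _ hlin
      rw [mul_neg_one] at h
      exact h.deriv
    · simp only [hki, if_false]
      have hne1 : j ≠ k := Ne.symm hkj
      have hne2 : i ≠ k := Ne.symm hki
      simp only [Function.update_of_ne hne1, Function.update_of_ne hne2, deriv_const']

/-! ### The generator on the elementary observables -/

/-- **`L(p_i²/2) = -p_i ∂_{q_i}H + γ([i=0](T_L - p_i²) + [i=N-1](T_R - p_i²))`** (no hypothesis on the
potentials: `∂_{q_i}H` is the tree's `partialQ`). [folklore] -/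
theorem generator_kinetic (P : OscillatorChain) (T_L T_R : ℝ) (i : Fin N) (x : PhaseSpace N) :
    P.generator N T_L T_R (fun z : PhaseSpace N => z.2 i ^ 2 / 2) x =
      -(x.2 i * partialQ i (P.hamiltonian N) x) +
        P.γ * ((if i.val = 0 then T_L - x.2 i ^ 2 else 0) + (if i.val = N - 1 then T_R - x.2 i ^ 2 else 0)) := by
  unfold OscillatorChain.generator
  simp only [partialP_kinetic, partialP_partialP_kinetic, partialQ_kinetic, mul_zero, zero_sub]
  have h1 : ∑ j : Fin N, -(partialQ j (P.hamiltonian N) x * if j = i then x.2 i else 0) =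
      -(x.2 i * partialQ i (P.hamiltonian N) x) := by
    rw [Finset.sum_eq_single_of_mem i (Finset.mem_univ _)]
    · simp only [if_true]; ring
    · intro j _ hj
      simp [hj]
  have h2 : ∀ j : Fin N, ((if j.val = 0 then T_L * (if j = i then (1:ℝ) else 0) - x.2 j * (if j = i then x.2 i else 0)
      else 0) + (if j.val = N - 1 then T_R * (if j = i then (1:ℝ) else 0) - x.2 j * (if j = i then x.2 i else 0)
      else 0)) = if j = i then ((if i.val = 0 then T_L - x.2 i ^ 2 else 0) +
        (if i.val = N - 1 then T_R - x.2 i ^ 2 else 0)) else 0 := by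
    intro j
    by_cases hji : j = i
    · subst hji
      simp only [if_true, mul_one]
      congr 1 <;> (split_ifs <;> ring)
    · simp [hji]
  rw [h1, Finset.sum_congr rfl fun j _ => h2 j, Finset.sum_ite_eq' Finset.univ i]
  simp

/-- **`L U(q_i) = p_i U'(q_i)`**. [folklore] -/
theorem generator_pinning (P : OscillatorChain) (T_L T_R : ℝ) (i : Fin N) (x : PhaseSpace N) :
    P.generator N T_L T_R (fun z : PhaseSpace N => P.U (z.1 i)) x = x.2 i * deriv P.U (x.1 i) := by
  unfold OscillatorChain.generator
  simp only [partialP_pinning_eq, partialQ_pinning, mul_zero, sub_zero, mul_ite]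
  have h0 : ∀ j : Fin N, partialP j (fun _ : PhaseSpace N => (0:ℝ)) x = 0 := fun j => by simp [partialP]
  simp only [h0, mul_zero, ite_self, add_zero, Finset.sum_const_zero]
  rw [Finset.sum_ite_eq' Finset.univ i]
  simp

/-- **`L V(q_j - q_i) = (p_j - p_i) V'(q_j - q_i)`** for `i ≠ j` and differentiable `V`. [folklore] -/
theorem generator_bondEnergy (P : OscillatorChain) (hV : Differentiable ℝ P.V) (T_L T_R : ℝ) {i j : Fin N}
    (hij : i ≠ j) (x : PhaseSpace N) :
    P.generator N T_L T_R (fun z : PhaseSpace N => P.V (z.1 j - z.1 i)) x =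
      (x.2 j - x.2 i) * deriv P.V (x.1 j - x.1 i) := by
  unfold OscillatorChain.generator
  simp only [partialP_bondEnergy_eq, partialQ_bondEnergy P hV hij, mul_zero, sub_zero]
  have h0 : ∀ k : Fin N, partialP k (fun _ : PhaseSpace N => (0:ℝ)) x = 0 := fun k => by simp [partialP]
  simp only [h0, mul_zero, ite_self, add_zero, Finset.sum_const_zero]
  rw [Fintype.sum_eq_add j i (Ne.symm hij)]
  · simp only [if_true, hij, if_false]
    ring
  · intro k ⟨hkj, hki⟩
    simp [hkj, hki]

/-! ### Energy bounds for chains with nonnegative, force-dominated potentials -/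

section Bounds

variable {P : OscillatorChain} (hU0 : ∀ q, 0 ≤ P.U q) (hV0 : ∀ r, 0 ≤ P.V r)
include hU0 hV0

/-- `|p_i| ≤ 1 + H` (`U, V ≥ 0`). [folklore] -/
theorem abs_momentum_le_one_add (x : PhaseSpace N) (i : Fin N) : |x.2 i| ≤ 1 + P.hamiltonian N x := by
  have h1 := P.site_le_hamiltonian hU0 hV0 N x i
  have h2 := hU0 (x.1 i)
  have h3 := abs_le_half_add_sq_half (x.2 i)
  linarith

/-- `p_i² ≤ 2H` (`U, V ≥ 0`). [folklore] -/
theorem sq_momentum_le (x : PhaseSpace N) (i : Fin N) : x.2 i ^ 2 ≤ 2 * P.hamiltonian N x := by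
  have h1 := P.site_le_hamiltonian hU0 hV0 N x i
  have h2 := hU0 (x.1 i)
  linarith

/-- `|∂_{q_i} H| ≤ (A + N²B)(1 + H)` when `|U'| ≤ A(1 + U)`, `|V'| ≤ B(1 + V)` (the tree's `abs_dPotential_le`).
[folklore] -/
theorem abs_partialQ_hamiltonian_le {A B : ℝ} (hA0 : 0 ≤ A) (hB0 : 0 ≤ B)
    (hA : ∀ q, |deriv P.U q| ≤ A * (1 + P.U q)) (hB : ∀ r, |deriv P.V r| ≤ B * (1 + P.V r))
    (hUd : Differentiable ℝ P.U) (hVd : Differentiable ℝ P.V) (x : PhaseSpace N) (i : Fin N) :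
    |partialQ i (P.hamiltonian N) x| ≤ (A + N ^ 2 * B) * (1 + P.hamiltonian N x) := by
  rw [P.partialQ_hamiltonian_eq_dPotential hUd hVd]
  exact P.abs_dPotential_le hA0 hB0 hA hB hU0 hV0 N x i

/-- `|p_i²/2| ≤ (1 + H)²`. [folklore] -/
theorem abs_kinetic_le (x : PhaseSpace N) (i : Fin N) : |x.2 i ^ 2 / 2| ≤ 1 * (1 + P.hamiltonian N x) ^ 2 := by
  have h1 := sq_momentum_le hU0 hV0 x i
  have hH := P.hamiltonian_nonneg_of_nonneg hU0 hV0 N x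
  rw [abs_of_nonneg (by positivity)]
  nlinarith

/-- `|∂_{p_j}(p_i²/2)| ≤ (1 + H)²`. [folklore] -/
theorem abs_partialP_kinetic_le (x : PhaseSpace N) (i j : Fin N) :
    |partialP j (fun z : PhaseSpace N => z.2 i ^ 2 / 2) x| ≤ 1 * (1 + P.hamiltonian N x) ^ 2 := by
  rw [partialP_kinetic]
  have hH := P.hamiltonian_nonneg_of_nonneg hU0 hV0 N x
  split_ifs
  · have h1 := abs_momentum_le_one_add hU0 hV0 x i
    nlinarith
  · rw [abs_zero]; positivity

/-- `|L(p_i²/2)| ≤ (A + N²B + |γ|(|T_L| + |T_R| + 4))(1 + H)²`. [folklore] -/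
theorem abs_generator_kinetic_le {A B : ℝ} (hA0 : 0 ≤ A) (hB0 : 0 ≤ B)
    (hA : ∀ q, |deriv P.U q| ≤ A * (1 + P.U q)) (hB : ∀ r, |deriv P.V r| ≤ B * (1 + P.V r))
    (hUd : Differentiable ℝ P.U) (hVd : Differentiable ℝ P.V) (T_L T_R : ℝ) (x : PhaseSpace N) (i : Fin N) :
    |P.generator N T_L T_R (fun z : PhaseSpace N => z.2 i ^ 2 / 2) x| ≤
      (A + N ^ 2 * B + |P.γ| * (|T_L| + |T_R| + 4)) * (1 + P.hamiltonian N x) ^ 2 := by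
  rw [generator_kinetic]
  have hH := P.hamiltonian_nonneg_of_nonneg hU0 hV0 N x
  have hp := abs_momentum_le_one_add hU0 hV0 x i
  have hp2 := sq_momentum_le hU0 hV0 x i
  have hF := abs_partialQ_hamiltonian_le hU0 hV0 hA0 hB0 hA hB hUd hVd x i
  set K := A + N ^ 2 * B with hK
  have hK0 : 0 ≤ K := by positivity
  have h1 : |-(x.2 i * partialQ i (P.hamiltonian N) x)| ≤ K * (1 + P.hamiltonian N x) ^ 2 := by
    rw [abs_neg, abs_mul]
    calc |x.2 i| * |partialQ i (P.hamiltonian N) x| ≤ (1 + P.hamiltonian N x) * (K * (1 + P.hamiltonian N x)) :=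
          mul_le_mul hp hF (abs_nonneg _) (by positivity)
      _ = K * (1 + P.hamiltonian N x) ^ 2 := by ring
  have hbath : ∀ (T : ℝ) (c : ℕ), |(if i.val = c then T - x.2 i ^ 2 else 0)| ≤ |T| + 2 * P.hamiltonian N x := by
    intro T c
    split_ifs
    · calc |T - x.2 i ^ 2| ≤ |T| + |x.2 i ^ 2| := abs_sub _ _
        _ ≤ |T| + 2 * P.hamiltonian N x := by rw [abs_of_nonneg (sq_nonneg (x.2 i))]; linarith
    · rw [abs_zero]; positivity
  have h2 : |P.γ * ((if i.val = 0 then T_L - x.2 i ^ 2 else 0) + (if i.val = N - 1 then T_R - x.2 i ^ 2 else 0))| ≤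
      |P.γ| * (|T_L| + |T_R| + 4) * (1 + P.hamiltonian N x) ^ 2 := by
    rw [abs_mul]
    have h3 := (abs_add_le _ _).trans (add_le_add (hbath T_L 0) (hbath T_R (N - 1)))
    calc |P.γ| * |((if i.val = 0 then T_L - x.2 i ^ 2 else 0) + (if i.val = N - 1 then T_R - x.2 i ^ 2 else 0))|
        ≤ |P.γ| * (|T_L| + 2 * P.hamiltonian N x + (|T_R| + 2 * P.hamiltonian N x)) :=
          mul_le_mul_of_nonneg_left h3 (abs_nonneg _)
      _ ≤ |P.γ| * ((|T_L| + |T_R| + 4) * (1 + P.hamiltonian N x) ^ 2) := by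
          refine mul_le_mul_of_nonneg_left ?_ (abs_nonneg _)
          nlinarith [mul_nonneg (add_nonneg (abs_nonneg T_L) (abs_nonneg T_R)) hH,
            mul_nonneg (add_nonneg (abs_nonneg T_L) (abs_nonneg T_R)) (sq_nonneg (P.hamiltonian N x)),
            sq_nonneg (P.hamiltonian N x), hH, abs_nonneg T_L, abs_nonneg T_R]
      _ = _ := by ring
  calc _ ≤ |-(x.2 i * partialQ i (P.hamiltonian N) x)| +
        |P.γ * ((if i.val = 0 then T_L - x.2 i ^ 2 else 0) + (if i.val = N - 1 then T_R - x.2 i ^ 2 else 0))| :=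
        abs_add_le _ _
    _ ≤ K * (1 + P.hamiltonian N x) ^ 2 + |P.γ| * (|T_L| + |T_R| + 4) * (1 + P.hamiltonian N x) ^ 2 := add_le_add h1 h2
    _ = _ := by ring

/-- `|U(q_i)| ≤ (1 + H)²`. [folklore] -/
theorem abs_pinning_le (x : PhaseSpace N) (i : Fin N) : |P.U (x.1 i)| ≤ 1 * (1 + P.hamiltonian N x) ^ 2 := by
  have h1 := P.site_le_hamiltonian hU0 hV0 N x i
  have h2 := hU0 (x.1 i)
  have hH := P.hamiltonian_nonneg_of_nonneg hU0 hV0 N x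
  rw [abs_of_nonneg h2]
  nlinarith [sq_nonneg (x.2 i)]

/-- `|L U(q_i)| = |p_i U'(q_i)| ≤ A (1 + H)²` when `|U'| ≤ A(1 + U)`. [folklore] -/
theorem abs_generator_pinning_le {A : ℝ} (hA0 : 0 ≤ A) (hA : ∀ q, |deriv P.U q| ≤ A * (1 + P.U q)) (T_L T_R : ℝ)
    (x : PhaseSpace N) (i : Fin N) :
    |P.generator N T_L T_R (fun z : PhaseSpace N => P.U (z.1 i)) x| ≤ A * (1 + P.hamiltonian N x) ^ 2 := by
  rw [generator_pinning, abs_mul]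
  have h1 := P.site_le_hamiltonian hU0 hV0 N x i
  have hp := abs_momentum_le_one_add hU0 hV0 x i
  have hU' := hA (x.1 i)
  have hH := P.hamiltonian_nonneg_of_nonneg hU0 hV0 N x
  calc |x.2 i| * |deriv P.U (x.1 i)| ≤ (1 + P.hamiltonian N x) * (A * (1 + P.hamiltonian N x)) := by
        refine mul_le_mul hp (hU'.trans ?_) (abs_nonneg _) (by positivity)
        refine mul_le_mul_of_nonneg_left ?_ hA0
        nlinarith [sq_nonneg (x.2 i)]
    _ = _ := by ring

/-- `|V(q_j - q_i)| ≤ (1 + H)²` for a bond `j = i + 1`. [folklore] -/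
theorem abs_bondEnergy_le (x : PhaseSpace N) {i j : Fin N} (hij : j.val = i.val + 1) :
    |P.V (x.1 j - x.1 i)| ≤ 1 * (1 + P.hamiltonian N x) ^ 2 := by
  have h1 := P.bond_le_hamiltonian hU0 hV0 N x hij
  have h2 := hV0 (x.1 j - x.1 i)
  have hH := P.hamiltonian_nonneg_of_nonneg hU0 hV0 N x
  rw [abs_of_nonneg h2]
  nlinarith

/-- `|L V(q_j - q_i)| ≤ 2B (1 + H)²` for a bond `j = i + 1` when `|V'| ≤ B(1 + V)`. [folklore] -/
theorem abs_generator_bondEnergy_le {B : ℝ} (hB0 : 0 ≤ B) (hB : ∀ r, |deriv P.V r| ≤ B * (1 + P.V r))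
    (hVd : Differentiable ℝ P.V) (T_L T_R : ℝ) (x : PhaseSpace N) {i j : Fin N} (hij : j.val = i.val + 1) :
    |P.generator N T_L T_R (fun z : PhaseSpace N => P.V (z.1 j - z.1 i)) x| ≤
      2 * B * (1 + P.hamiltonian N x) ^ 2 := by
  have hne : i ≠ j := by intro h; rw [h] at hij; omega
  rw [generator_bondEnergy P hVd T_L T_R hne, abs_mul]
  have h1 := P.bond_le_hamiltonian hU0 hV0 N x hij
  have hpi := abs_momentum_le_one_add hU0 hV0 x i
  have hpj := abs_momentum_le_one_add hU0 hV0 x j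
  have hV' := hB (x.1 j - x.1 i)
  have hH := P.hamiltonian_nonneg_of_nonneg hU0 hV0 N x
  calc |x.2 j - x.2 i| * |deriv P.V (x.1 j - x.1 i)| ≤
      (2 * (1 + P.hamiltonian N x)) * (B * (1 + P.hamiltonian N x)) := by
        refine mul_le_mul ?_ (hV'.trans ?_) (abs_nonneg _) (by positivity)
        · calc |x.2 j - x.2 i| ≤ |x.2 j| + |x.2 i| := abs_sub _ _
            _ ≤ 2 * (1 + P.hamiltonian N x) := by linarith
        · exact mul_le_mul_of_nonneg_left (by linarith) hB0
    _ = _ := by ring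

end Bounds

/-- **The elementary observables of the pinned chain are admissible for weak stationarity** (registered sub-goal
of `stub_steadyHeatRates`): for `ω₂ > 0`, `lam, β, γ ≥ 0`, every `N`, `T_L, T_R`, there is ONE constant `C` such that
the kinetic energies `p_i²/2`, the pinning energies `U(q_i)` and the bond energies `V(q_j - q_i)` (`j = i + 1`),
their generators and their momentum derivatives are all bounded by `C (1 + H)²` (the pinned potentials are
nonnegative and force-dominated, `pinnedChain_isConfining`). [folklore] -/
theorem pinnedChain_elementaryBounds :
    ∀ (ω₂ lam β γ : ℝ), 0 < ω₂ → 0 ≤ lam → 0 ≤ β → 0 ≤ γ → ∀ (N : ℕ) (T_L T_R : ℝ), ∃ C : ℝ,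
    (∀ (i : Fin N) (x : PhaseSpace N), |x.2 i ^ 2 / 2| ≤ C * (1 + (pinnedChain ω₂ lam β γ).hamiltonian N x) ^ 2) ∧
    (∀ (i : Fin N) (x : PhaseSpace N),
      |(pinnedChain ω₂ lam β γ).generator N T_L T_R (fun z : PhaseSpace N => z.2 i ^ 2 / 2) x| ≤
        C * (1 + (pinnedChain ω₂ lam β γ).hamiltonian N x) ^ 2) ∧
    (∀ (i l : Fin N) (x : PhaseSpace N), |partialP l (fun z : PhaseSpace N => z.2 i ^ 2 / 2) x| ≤
        C * (1 + (pinnedChain ω₂ lam β γ).hamiltonian N x) ^ 2) ∧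
    (∀ (i : Fin N) (x : PhaseSpace N), |(pinnedChain ω₂ lam β γ).U (x.1 i)| ≤
        C * (1 + (pinnedChain ω₂ lam β γ).hamiltonian N x) ^ 2) ∧
    (∀ (i : Fin N) (x : PhaseSpace N),
      |(pinnedChain ω₂ lam β γ).generator N T_L T_R (fun z : PhaseSpace N => (pinnedChain ω₂ lam β γ).U (z.1 i)) x| ≤
        C * (1 + (pinnedChain ω₂ lam β γ).hamiltonian N x) ^ 2) ∧
    (∀ (i l : Fin N) (x : PhaseSpace N),
      |partialP l (fun z : PhaseSpace N => (pinnedChain ω₂ lam β γ).U (z.1 i)) x| ≤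
        C * (1 + (pinnedChain ω₂ lam β γ).hamiltonian N x) ^ 2) ∧
    (∀ (i j : Fin N) (x : PhaseSpace N), j.val = i.val + 1 →
      |(pinnedChain ω₂ lam β γ).V (x.1 j - x.1 i)| ≤ C * (1 + (pinnedChain ω₂ lam β γ).hamiltonian N x) ^ 2) ∧
    (∀ (i j : Fin N) (x : PhaseSpace N), j.val = i.val + 1 →
      |(pinnedChain ω₂ lam β γ).generator N T_L T_R
          (fun z : PhaseSpace N => (pinnedChain ω₂ lam β γ).V (z.1 j - z.1 i)) x| ≤
        C * (1 + (pinnedChain ω₂ lam β γ).hamiltonian N x) ^ 2) ∧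
    (∀ (i j l : Fin N) (x : PhaseSpace N),
      |partialP l (fun z : PhaseSpace N => (pinnedChain ω₂ lam β γ).V (z.1 j - z.1 i)) x| ≤
        C * (1 + (pinnedChain ω₂ lam β γ).hamiltonian N x) ^ 2) := by
  intro ω₂ lam β γ hω hl hβ hγ N T_L T_R
  have hP := pinnedChain_isConfining hω hl hβ hγ
  have hU0 := hP.U_nonneg
  have hV0 := hP.V_nonneg
  obtain ⟨A, hA0, hA⟩ := hP.exists_abs_deriv_U_le
  obtain ⟨B, hB0, hB⟩ := hP.exists_abs_deriv_V_le
  have hUd := hP.differentiable_U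
  have hVd := hP.differentiable_V
  have hX : 0 ≤ |(pinnedChain ω₂ lam β γ).γ| * (|T_L| + |T_R| + 4) := by positivity
  have hNB : 0 ≤ (N : ℝ) ^ 2 * B := by positivity
  refine ⟨1 + (A + N ^ 2 * B + |(pinnedChain ω₂ lam β γ).γ| * (|T_L| + |T_R| + 4)) + A + 2 * B,
    ?_, ?_, ?_, ?_, ?_, ?_, ?_, ?_, ?_⟩
  · intro i x
    refine (abs_kinetic_le hU0 hV0 x i).trans (mul_le_mul_of_nonneg_right ?_ (by positivity))
    nlinarith [hX, hNB]
  · intro i x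
    refine (abs_generator_kinetic_le hU0 hV0 hA0 hB0 hA hB hUd hVd T_L T_R x i).trans
      (mul_le_mul_of_nonneg_right ?_ (by positivity))
    nlinarith [hX, hNB]
  · intro i l x
    refine (abs_partialP_kinetic_le hU0 hV0 x i l).trans (mul_le_mul_of_nonneg_right ?_ (by positivity))
    nlinarith [hX, hNB]
  · intro i x
    refine (abs_pinning_le hU0 hV0 x i).trans (mul_le_mul_of_nonneg_right ?_ (by positivity))
    nlinarith [hX, hNB]
  · intro i x
    refine (abs_generator_pinning_le hU0 hV0 hA0 hA T_L T_R x i).trans (mul_le_mul_of_nonneg_right ?_ (by positivity))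
    nlinarith [hX, hNB]
  · intro i l x
    have hH := hP.hamiltonian_nonneg N x
    simp only [partialP_pinning_eq, abs_zero]; positivity
  · intro i j x hij
    refine (abs_bondEnergy_le hU0 hV0 x hij).trans (mul_le_mul_of_nonneg_right ?_ (by positivity))
    nlinarith [hX, hNB]
  · intro i j x hij
    refine (abs_generator_bondEnergy_le hU0 hV0 hB0 hB hVd T_L T_R x hij).trans
      (mul_le_mul_of_nonneg_right ?_ (by positivity))
    nlinarith [hX, hNB]
  · intro i j l x
    have hH := hP.hamiltonian_nonneg N x
    simp only [partialP_bondEnergy_eq, abs_zero]; positivity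

end Summit.AtomisticToContinuum.FouriersLaw.Theorems.LinearResponseFTUR

end
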